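import Summits.BirchSwinnertonDyer.BirchSwinnertonDyer.Theorems.PrintCf2SplitBadTwoLayerLocSurjLevels
import Summits.BirchSwinnertonDyer.BirchSwinnertonDyer.Theorems.PrintCf2SplitBadTwoUpperBaseLiftCoeffLevels
import HarnessLib

/-!
# Crux `PrintCf2.SplitBadTwoRankOneOfFacts` (stmt-BirchSwinnertonDyer-20368), skeleton v13.4, registered stub (REG₂) `stub_xRegular_two`,
# S3N-FACTFREE road R2, brick B3c: (SUR_U) FOR THE DIVISIBLE MODULE FROM (SUR_U) AT A PAIR OF FINITE LEVELS — the assembly of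
# -w4 g12's B3 (`locSurj_of_forall_torsionExponent`, p700951) with -w5 g7's level lift / transport (p703310)

Cell `bsd-print-cf2`, WIDTH seat `bsd-line-cf2-p1-w8` g5 (prover-bsd-line-cf2-p1-w8-g5-0); `--supports stmt-BirchSwinnertonDyer-20368`
(helper, Theses-free). HONEST FRAMING: nothing here closes the crux or a registered stub; BSD is not proved by any of this; no summit
statement is proved by this seat. No definition, no named fact, no `sorry`. Unconditional.

WHAT. `K` a number field, `U ⊴ Γ_K`, `A` a discrete `Γ_K`-module with open stabilisers (`hA`), `p`, `v̄`, an exponent `k` with `A`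
`p^k`-divisible (`hdiv`), and a PAIR OF LEVELS: finite discrete `Γ_K`-modules `N₀ →j N` with injective equivariant `ι₀ : N₀ → A` onto
`⊇ A[p^k]` (`hrange₀`) and equivariant `ι : N → A` with `ι ∘ j = ι₀`.
* `isOpen_stabilizer_decompIn` — the stabilisers of `A` in `U ⊓ D_w` are open (plumbing for the level descent on the local groups).
* **`locSurj_torsionExponent_of_levelSurj`** — IF (SUR_U) holds AT THE LEVELS, i.e. every family of layer-local targets
  `τ₀ w q ∈ H¹(U ⊓ D_w^{q}, N₀)` above a finite `T` (`w ∤ p` or `w = v̄`) is realised by some `z ∈ H¹(U, N)` — `res(conj_{q.out} z) ≡ j_* τ₀ w q`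
  modulo classes dying on `U ⊓ I_w`, and `z` unramified above every other `w ∤ p` / `v̄` (EXACTLY the conclusion of B2c
  `LayerShapiro.exists_layerClass_of_dualPullback_eq_zero`, p702949, and of B2d `exists_layerClass_of_layerProNull`, p705484) — THEN (SUR_U)
  holds for `A` and every target family KILLED BY `p^k` (EXACTLY the `hLSk k` input of -w4 g12's `UpperBaseLift.locSurj_of_forall_torsionExponent` /
  `locSurj_layerSubgroup_of_forall_torsionExponent`, p700951). Proof: descend each target to `N₀` (-w5 g7 `exists_resH1Hom_eq_of_nsmul_eq_zero`
  on `U ⊓ D_w`), solve at the levels, push the solution to `A` along `ι` (`resOfLe_sub_eq_zero_of_level`, `forall_conjH1_resH1Hom_mem_unramifiedKer`).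
* **`locSurj_of_levelSurj`** / **`locSurj_layerSubgroup_of_levelSurj`** — with a level pair for EVERY `k` (families `N₀ k`, `N k` indexed by `k`;
  `A` `p`-primary and divisible): (SUR_U) for `A` on the nose / at `U = κ.layerSubgroup n` (the `hLSn n` input of p700059 `locSurj_of_layers`).
USE: ROAD (b) of (REG₂): B2d (p705484) ∘ class-level (PRO-NULL)_U (-w3 g13 p703858 / p704411) ∘ B5-U give the level hypothesis; this file
turns it into (LSₙ); -w2 g14's `XRegPinned.stub_xRegular_two_of_locSurjLayers` (p704095) ends in the registered stub. presearch: GV2000 §2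
Prop. 2.1, Greenberg LNM 1716 §5 p. 114 (Kummer lift) — assembly of tree theorems, no new fact. beyond-print theorem: no.

References: [GreenbergVatsal2000] §2 Prop. 2.1; [GreenbergLNM1716] §4 Props. 4.13–4.15, §5 p. 114; [SerreGaloisCohomology1997] I §2.2, §5.1.
-/

noncomputable section

open scoped Classical

set_option linter.dupNamespace false
set_option autoImplicit false

open NumberField IsDedekindDomain Field
open Literature.NumberTheory.EllipticCurves Literature.NumberTheory.EllipticCurves.GreenbergSelmer
open Literature.NumberTheory.EllipticCurves.GreenbergVatsal2000
open Literature.NumberTheory.GaloisRepresentations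

namespace Summit.BirchSwinnertonDyer.BirchSwinnertonDyer.Theorems.PrintCf2.LayerShapiro

variable {K : Type} [Field K] [NumberField K] (U : Subgroup (absoluteGaloisGroup K)) [U.Normal]
  {A : Type} [AddCommGroup A] [DistribMulAction (absoluteGaloisGroup K) A] [TopologicalSpace A] [DiscreteTopology A]
  (hA : ∀ a : A, IsOpen {σ : absoluteGaloisGroup K | σ • a = a})
  {p : ℕ} (vbar : HeightOneSpectrum (𝓞 K))

include hA

omit [NumberField K] [U.Normal] [TopologicalSpace A] [DiscreteTopology A] in
/-- The stabilisers of a discrete `Γ_K`-module with open stabilisers stay open in the local subgroup `U ⊓ D_w` (preimage under the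
continuous inclusion `U ⊓ D_w → Γ_K`). [cite: SerreGaloisCohomology1997, I §2.2] -/
theorem isOpen_stabilizer_decompIn [NumberField K] (w : HeightOneSpectrum (𝓞 K)) (a : A) :
    IsOpen (MulAction.stabilizer (decompIn U w) a : Set (decompIn U w)) := by
  have e : (MulAction.stabilizer (decompIn U w) a : Set (decompIn U w)) =
      (fun d : decompIn U w ↦ ((d : decomp (K := K) w) : absoluteGaloisGroup K)) ⁻¹' {σ : absoluteGaloisGroup K | σ • a = a} := by
    ext d
    rfl
  rw [e]
  exact (hA a).preimage (continuous_subtype_val.comp continuous_subtype_val)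

variable {N₀ N : Type} [AddCommGroup N₀] [DistribMulAction (absoluteGaloisGroup K) N₀] [TopologicalSpace N₀] [DiscreteTopology N₀]
  [AddCommGroup N] [DistribMulAction (absoluteGaloisGroup K) N] [TopologicalSpace N] [DiscreteTopology N]

/-- **(SUR_U) FOR `p^k`-TORSION TARGETS IN `A` FROM (SUR_U) AT THE LEVELS `N₀ →j N`.** See the module docstring: the conclusion is
VERBATIM the body of the `hLSk k` hypothesis of `UpperBaseLift.locSurj_of_forall_torsionExponent` (p700951); the hypothesis `hlev` is
VERBATIM the conclusion of B2c/B2d (`exists_layerClass_of_dualPullback_eq_zero` p702949 / `exists_layerClass_of_layerProNull` p705484) for the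
pair `(N₀, N, j)`. [cite: GreenbergVatsal2000, §2 Prop. 2.1] [cite: GreenbergLNM1716, §5 p. 114] -/
theorem locSurj_torsionExponent_of_levelSurj (k : ℕ) (hdiv : ∀ a : A, ∃ b : A, p ^ k • b = a)
    (ι₀ : N₀ →+ A) (hι₀ : ∀ (g : absoluteGaloisGroup K) (m : N₀), ι₀ (g • m) = g • ι₀ m) (hι₀inj : Function.Injective ι₀)
    (hrange₀ : ∀ a : A, p ^ k • a = 0 → ∃ m, ι₀ m = a)
    (ι : N →+ A) (hι : ∀ (g : absoluteGaloisGroup K) (m : N), ι (g • m) = g • ι m)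
    (j : N₀ →+ N) (hj : ∀ (g : absoluteGaloisGroup K) (m : N₀), j (g • m) = g • j m) (hcomp : ∀ m, ι (j m) = ι₀ m)
    (hlev : ∀ (T : Finset (HeightOneSpectrum (𝓞 K))), (∀ w ∈ T, ((p : ℕ) : 𝓞 K) ∉ w.asIdeal ∨ w = vbar) →
      ∀ τ₀ : (w : HeightOneSpectrum (𝓞 K)) →
        DoubleCoset.Quotient (decomp (K := K) w : Set (absoluteGaloisGroup K)) (U : Set (absoluteGaloisGroup K)) →
          subgroupH1 (decompIn U w) N₀,
      ∃ z : subgroupH1 U N,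
        (∀ w ∈ T, ∀ q : DoubleCoset.Quotient (decomp (K := K) w : Set (absoluteGaloisGroup K)) (U : Set (absoluteGaloisGroup K)),
          resOfLe N (inertiaIn_le_decompIn U w)
            (resH1Hom (decompInToH U w) (AddMonoidHom.id N) (fun _ _ ↦ rfl) (conjH1 U N q.out z) -
              resH1Hom (ContinuousMonoidHom.id (decompIn U w)) j (fun _ m ↦ hj _ m) (τ₀ w q)) = 0) ∧
        (∀ w : HeightOneSpectrum (𝓞 K), w ∉ T → (((p : ℕ) : 𝓞 K) ∉ w.asIdeal ∨ w = vbar) →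
          ∀ σ : absoluteGaloisGroup K, conjH1 U N σ z ∈ GreenbergVatsal2000.unramifiedKer U N w)) :
    ∀ (T : Finset (HeightOneSpectrum (𝓞 K))), (∀ w ∈ T, ((p : ℕ) : 𝓞 K) ∉ w.asIdeal ∨ w = vbar) →
      ∀ τ : (w : HeightOneSpectrum (𝓞 K)) →
        DoubleCoset.Quotient (decomp (K := K) w : Set (absoluteGaloisGroup K)) (U : Set (absoluteGaloisGroup K)) →
          subgroupH1 (decompIn U w) A,
      (∀ w ∈ T, ∀ q, p ^ k • τ w q = 0) →
      ∃ z : subgroupH1 U A,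
        (∀ w ∈ T, ∀ q : DoubleCoset.Quotient (decomp (K := K) w : Set (absoluteGaloisGroup K)) (U : Set (absoluteGaloisGroup K)),
          resOfLe A (inertiaIn_le_decompIn U w)
            (resH1Hom (decompInToH U w) (AddMonoidHom.id A) (fun _ _ ↦ rfl) (conjH1 U A q.out z) - τ w q) = 0) ∧
        (∀ w : HeightOneSpectrum (𝓞 K), w ∉ T → (((p : ℕ) : 𝓞 K) ∉ w.asIdeal ∨ w = vbar) →
          ∀ σ : absoluteGaloisGroup K, conjH1 U A σ z ∈ GreenbergVatsal2000.unramifiedKer U A w) := by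
  intro T hT τ hτ
  -- descend the targets above `T` to the level `N₀` (zero elsewhere)
  have hdesc : ∀ (w : HeightOneSpectrum (𝓞 K))
      (q : DoubleCoset.Quotient (decomp (K := K) w : Set (absoluteGaloisGroup K)) (U : Set (absoluteGaloisGroup K))),
      ∃ τ₀ : subgroupH1 (decompIn U w) N₀, w ∈ T →
        resH1Hom (ContinuousMonoidHom.id (decompIn U w)) ι₀ (fun _ m ↦ hι₀ _ m) τ₀ = τ w q := by
    intro w q
    by_cases hw : w ∈ T
    · obtain ⟨y, hy⟩ := exists_resH1Hom_eq_of_nsmul_eq_zero (G := decompIn U w) (isOpen_stabilizer_decompIn U hA w) ι₀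
        (fun g m ↦ hι₀ _ m) hι₀inj (p ^ k) hrange₀ hdiv (τ w q) (hτ w hw q)
      exact ⟨y, fun _ ↦ hy⟩
    · exact ⟨0, fun h ↦ absurd h hw⟩
  choose τ₀ hτ₀ using hdesc
  -- solve at the levels and push to `A`
  obtain ⟨z, h1, h2⟩ := hlev T hT τ₀
  refine ⟨resH1Hom (ContinuousMonoidHom.id U) ι (fun g m ↦ hι g m) z, fun w hw q ↦ ?_, fun w hwT hw σ ↦ ?_⟩
  · have h := resOfLe_sub_eq_zero_of_level U w ι hι j hj ι₀ hι₀ hcomp q z (τ₀ w q) (h1 w hw q)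
    rwa [hτ₀ w q hw] at h
  · exact forall_conjH1_resH1Hom_mem_unramifiedKer U w ι hι (h2 w hwT hw) σ

/-- **(SUR_U) FOR A `p`-PRIMARY DIVISIBLE `A` FROM (SUR_U) AT A LEVEL PAIR FOR EVERY EXPONENT.** Families of levels `N₀ k ↪ A` (onto
`⊇ A[p^k]`) and `N k → A` with level maps `j k : N₀ k → N k`; `U` closed, finitely many places of `K̄^U` above every `w ∤ p` / `v̄`. If
(SUR_U) holds at the pair `(N₀ k, N k)` for every `k`, it holds for `A` (-w4 g12's `locSurj_of_forall_torsionExponent` over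
`locSurj_torsionExponent_of_levelSurj`). [cite: GreenbergVatsal2000, §2 Prop. 2.1] [cite: GreenbergLNM1716, §4 Props. 4.13–4.15] -/
theorem locSurj_of_levelSurj [Fact p.Prime] (hU : IsClosed (U : Set (absoluteGaloisGroup K)))
    (htor : ∀ a : A, ∃ k : ℕ, p ^ k • a = 0) (hdiv : ∀ (k : ℕ) (a : A), ∃ b : A, p ^ k • b = a)
    (hfin : ∀ w : HeightOneSpectrum (𝓞 K), (((p : ℕ) : 𝓞 K) ∉ w.asIdeal ∨ w = vbar) →
      Finite (DoubleCoset.Quotient (decomp (K := K) w : Set (absoluteGaloisGroup K)) (U : Set (absoluteGaloisGroup K))))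
    (L₀ L : ℕ → Type) [∀ k, AddCommGroup (L₀ k)] [∀ k, DistribMulAction (absoluteGaloisGroup K) (L₀ k)]
    [∀ k, TopologicalSpace (L₀ k)] [∀ k, DiscreteTopology (L₀ k)]
    [∀ k, AddCommGroup (L k)] [∀ k, DistribMulAction (absoluteGaloisGroup K) (L k)] [∀ k, TopologicalSpace (L k)]
    [∀ k, DiscreteTopology (L k)]
    (ι₀ : ∀ k, L₀ k →+ A) (hι₀ : ∀ k (g : absoluteGaloisGroup K) (m : L₀ k), ι₀ k (g • m) = g • ι₀ k m)
    (hι₀inj : ∀ k, Function.Injective (ι₀ k)) (hrange₀ : ∀ k (a : A), p ^ k • a = 0 → ∃ m, ι₀ k m = a)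
    (ι : ∀ k, L k →+ A) (hι : ∀ k (g : absoluteGaloisGroup K) (m : L k), ι k (g • m) = g • ι k m)
    (j : ∀ k, L₀ k →+ L k) (hj : ∀ k (g : absoluteGaloisGroup K) (m : L₀ k), j k (g • m) = g • j k m)
    (hcomp : ∀ k m, ι k (j k m) = ι₀ k m)
    (hlev : ∀ (k : ℕ) (T : Finset (HeightOneSpectrum (𝓞 K))), (∀ w ∈ T, ((p : ℕ) : 𝓞 K) ∉ w.asIdeal ∨ w = vbar) →
      ∀ τ₀ : (w : HeightOneSpectrum (𝓞 K)) →
        DoubleCoset.Quotient (decomp (K := K) w : Set (absoluteGaloisGroup K)) (U : Set (absoluteGaloisGroup K)) →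
          subgroupH1 (decompIn U w) (L₀ k),
      ∃ z : subgroupH1 U (L k),
        (∀ w ∈ T, ∀ q : DoubleCoset.Quotient (decomp (K := K) w : Set (absoluteGaloisGroup K)) (U : Set (absoluteGaloisGroup K)),
          resOfLe (L k) (inertiaIn_le_decompIn U w)
            (resH1Hom (decompInToH U w) (AddMonoidHom.id (L k)) (fun _ _ ↦ rfl) (conjH1 U (L k) q.out z) -
              resH1Hom (ContinuousMonoidHom.id (decompIn U w)) (j k) (fun _ m ↦ hj k _ m) (τ₀ w q)) = 0) ∧
        (∀ w : HeightOneSpectrum (𝓞 K), w ∉ T → (((p : ℕ) : 𝓞 K) ∉ w.asIdeal ∨ w = vbar) →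
          ∀ σ : absoluteGaloisGroup K, conjH1 U (L k) σ z ∈ GreenbergVatsal2000.unramifiedKer U (L k) w)) :
    ∀ (T : Finset (HeightOneSpectrum (𝓞 K))), (∀ w ∈ T, ((p : ℕ) : 𝓞 K) ∉ w.asIdeal ∨ w = vbar) →
      ∀ τ : (w : HeightOneSpectrum (𝓞 K)) →
        DoubleCoset.Quotient (decomp (K := K) w : Set (absoluteGaloisGroup K)) (U : Set (absoluteGaloisGroup K)) →
          subgroupH1 (decompIn U w) A,
      ∃ z : subgroupH1 U A,
        (∀ w ∈ T, ∀ q : DoubleCoset.Quotient (decomp (K := K) w : Set (absoluteGaloisGroup K)) (U : Set (absoluteGaloisGroup K)),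
          resOfLe A (inertiaIn_le_decompIn U w)
            (resH1Hom (decompInToH U w) (AddMonoidHom.id A) (fun _ _ ↦ rfl) (conjH1 U A q.out z) - τ w q) = 0) ∧
        (∀ w : HeightOneSpectrum (𝓞 K), w ∉ T → (((p : ℕ) : 𝓞 K) ∉ w.asIdeal ∨ w = vbar) →
          ∀ σ : absoluteGaloisGroup K, conjH1 U A σ z ∈ GreenbergVatsal2000.unramifiedKer U A w) :=
  UpperBaseLift.locSurj_of_forall_torsionExponent U A hU htor hfin fun k ↦
    locSurj_torsionExponent_of_levelSurj U hA vbar k (hdiv k) (ι₀ k) (hι₀ k) (hι₀inj k) (hrange₀ k) (ι k) (hι k) (j k) (hj k)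
      (hcomp k) (hlev k)

/-- **The same at a layer `U = κ.layerSubgroup n` of a `ℤ_p`-extension** (finiteness of the places above `w ∤ p` / `v̄` from «no such place
splits completely in `K_∞`», -w8 g4 `LineDoubleCoset…`; -w4 g12's `locSurj_layerSubgroup_of_forall_torsionExponent`): the conclusion is
VERBATIM the `hLSn n` input of `UpperBaseLift.locSurj_of_layers` (p700059) / `XRegPinned.xRegular_char_of_layers` (p702770).
[cite: GreenbergVatsal2000, §2 Prop. 2.1] [cite: GreenbergLNM1716, §4 Props. 4.13–4.15] -/
theorem locSurj_layerSubgroup_of_levelSurj [Fact p.Prime] (κ : ZpExtension K p) (n : ℕ)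
    (htor : ∀ a : A, ∃ k : ℕ, p ^ k • a = 0) (hdiv : ∀ (k : ℕ) (a : A), ∃ b : A, p ^ k • b = a)
    (hD : ∀ w : HeightOneSpectrum (𝓞 K), (((p : ℕ) : 𝓞 K) ∉ w.asIdeal ∨ w = vbar) → ¬ decomp (K := K) w ≤ κ.kerSubgroup)
    (L₀ L : ℕ → Type) [∀ k, AddCommGroup (L₀ k)] [∀ k, DistribMulAction (absoluteGaloisGroup K) (L₀ k)]
    [∀ k, TopologicalSpace (L₀ k)] [∀ k, DiscreteTopology (L₀ k)]
    [∀ k, AddCommGroup (L k)] [∀ k, DistribMulAction (absoluteGaloisGroup K) (L k)] [∀ k, TopologicalSpace (L k)]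
    [∀ k, DiscreteTopology (L k)]
    (ι₀ : ∀ k, L₀ k →+ A) (hι₀ : ∀ k (g : absoluteGaloisGroup K) (m : L₀ k), ι₀ k (g • m) = g • ι₀ k m)
    (hι₀inj : ∀ k, Function.Injective (ι₀ k)) (hrange₀ : ∀ k (a : A), p ^ k • a = 0 → ∃ m, ι₀ k m = a)
    (ι : ∀ k, L k →+ A) (hι : ∀ k (g : absoluteGaloisGroup K) (m : L k), ι k (g • m) = g • ι k m)
    (j : ∀ k, L₀ k →+ L k) (hj : ∀ k (g : absoluteGaloisGroup K) (m : L₀ k), j k (g • m) = g • j k m)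
    (hcomp : ∀ k m, ι k (j k m) = ι₀ k m)
    (hlev : ∀ (k : ℕ) (T : Finset (HeightOneSpectrum (𝓞 K))), (∀ w ∈ T, ((p : ℕ) : 𝓞 K) ∉ w.asIdeal ∨ w = vbar) →
      ∀ τ₀ : (w : HeightOneSpectrum (𝓞 K)) →
        DoubleCoset.Quotient (decomp (K := K) w : Set (absoluteGaloisGroup K)) (κ.layerSubgroup n : Set (absoluteGaloisGroup K)) →
          subgroupH1 (decompIn (κ.layerSubgroup n) w) (L₀ k),
      ∃ z : subgroupH1 (κ.layerSubgroup n) (L k),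
        (∀ w ∈ T, ∀ q : DoubleCoset.Quotient (decomp (K := K) w : Set (absoluteGaloisGroup K))
            (κ.layerSubgroup n : Set (absoluteGaloisGroup K)),
          resOfLe (L k) (inertiaIn_le_decompIn (κ.layerSubgroup n) w)
            (resH1Hom (decompInToH (κ.layerSubgroup n) w) (AddMonoidHom.id (L k)) (fun _ _ ↦ rfl)
                (conjH1 (κ.layerSubgroup n) (L k) q.out z) -
              resH1Hom (ContinuousMonoidHom.id (decompIn (κ.layerSubgroup n) w)) (j k) (fun _ m ↦ hj k _ m) (τ₀ w q)) = 0) ∧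
        (∀ w : HeightOneSpectrum (𝓞 K), w ∉ T → (((p : ℕ) : 𝓞 K) ∉ w.asIdeal ∨ w = vbar) →
          ∀ σ : absoluteGaloisGroup K, conjH1 (κ.layerSubgroup n) (L k) σ z ∈
            GreenbergVatsal2000.unramifiedKer (κ.layerSubgroup n) (L k) w)) :
    ∀ (T : Finset (HeightOneSpectrum (𝓞 K))), (∀ w ∈ T, ((p : ℕ) : 𝓞 K) ∉ w.asIdeal ∨ w = vbar) →
      ∀ τ : (w : HeightOneSpectrum (𝓞 K)) →
        DoubleCoset.Quotient (decomp (K := K) w : Set (absoluteGaloisGroup K)) (κ.layerSubgroup n : Set (absoluteGaloisGroup K)) →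
          subgroupH1 (decompIn (κ.layerSubgroup n) w) A,
      ∃ z : subgroupH1 (κ.layerSubgroup n) A,
        (∀ w ∈ T, ∀ q : DoubleCoset.Quotient (decomp (K := K) w : Set (absoluteGaloisGroup K))
            (κ.layerSubgroup n : Set (absoluteGaloisGroup K)),
          resOfLe A (inertiaIn_le_decompIn (κ.layerSubgroup n) w)
            (resH1Hom (decompInToH (κ.layerSubgroup n) w) (AddMonoidHom.id A) (fun _ _ ↦ rfl)
              (conjH1 (κ.layerSubgroup n) A q.out z) - τ w q) = 0) ∧
        (∀ w : HeightOneSpectrum (𝓞 K), w ∉ T → (((p : ℕ) : 𝓞 K) ∉ w.asIdeal ∨ w = vbar) →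
          ∀ σ : absoluteGaloisGroup K, conjH1 (κ.layerSubgroup n) A σ z ∈
            GreenbergVatsal2000.unramifiedKer (κ.layerSubgroup n) A w) :=
  UpperBaseLift.locSurj_layerSubgroup_of_forall_torsionExponent (M := A) κ n htor hD fun k ↦
    locSurj_torsionExponent_of_levelSurj (κ.layerSubgroup n) hA vbar k (hdiv k) (ι₀ k) (hι₀ k) (hι₀inj k) (hrange₀ k) (ι k) (hι k)
      (j k) (hj k) (hcomp k) (hlev k)

end Summit.BirchSwinnertonDyer.BirchSwinnertonDyer.Theorems.PrintCf2.LayerShapiro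

end
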